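import Mathlib
import Summits.KontsevichZagierPeriods.Zeta5Search.DenomLaw.DoubleDropTwoKit
import HarnessLib

/-!
# ζ(5) search — the V-GAIN COVER KIT: `v_p(Cas_j(b)) ≥ 1 − N + row` when the only non-tame classes of exponent `≤ −N` are centre-free palindromic classes at `−N`, `N` even (DENOM-LAW D1, prover-d1 gen 23)

Cell `pub-zeta5` (HONEST FRAMING: systematic search; no irrationality claim unless certified), TRACK «DENOM-LAW» D1 prover seat
(denom-prover-d1 gen 23, `HOME/denom-law/prover-d1/ATTEMPT-23.md`).  The census's «V-GAIN» rung (classifier `VG`, even kind: the classes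
carrying the minimum `VB = −N` of `ν` are centre-free classes of ONE palindromic type, `N` even; their constant terms cancel in conjugate pairs,
so `v_p(V(b)) ≥ VB + 1`, and the same for `b + e_j`) in COVER FORM and for ANY even depth `N ≥ 1`, single-pole OR multipole carriers:
gen 23's `padicNorm_coeffV_le_ddTwo` (gen-2 g9's pairwise cancellation `padicNorm_classV_pair_le` with `1 ≤ N`), gen-2 g9's transport
`ddHyp_self` / `ddHyp_shift` (a class hit by the shift rises above `−N`; an unhit deep class keeps its palindromic exponent vector — no cover of
`b + e_j` is needed), and gen 12's row assembly `VCarrier.cas_val_ge_of_coeffV` with a row constant `R ≤ 1`, `R ≤ 3 + E_x` on multipole classes,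
dropped to `min R 0` at `d < p`: **`v_p(Cas_j(b)) ≥ (1 − N) + (R if p ≤ d, else min R 0)`** (`vgain_anyDepth`).  Cover form `vgain_of_cover`:
gen 10's `checkB` at `N` plus the multipole-row check on the type list.  `DoubleDropTwoKit` is the case `N = 2`, `R = 1`.  First consumers: the
two largest a = 6 profiles (`DenomLaw/ProfileA6TopPath`: six long parameters `b₇ < p ≤ b₆`, long pair blocks `(i,7)` resp. `(i,7),(5,6)`;
carriers = the non-tame single-pole classes `[0,−6,0]`, `N = 6`).  `p`-adic valuations of the cell's own rationals; nothing about ζ(5); no γ;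
records in print UNMOVED.
-/

noncomputable section

open Finset

namespace Summit.KontsevichZagierPeriods.Zeta5Search.DenomLaw

open Summit.KontsevichZagierPeriods.Zeta5Search.ClusterValuation
open Summit.KontsevichZagierPeriods.Zeta5Search.WedgeDictionary (coeffV dOf)
open Summit.KontsevichZagierPeriods.Zeta5Search.CasoratianValuation (InPolytope shift casoratian)
open Summit.KontsevichZagierPeriods.Zeta5Search.BigPrime (shift_zero)
open Summit.KontsevichZagierPeriods.Zeta5Search.PadicSeries
open Summit.KontsevichZagierPeriods.Zeta5Search.ClassTypeCover

variable {p : ℕ} [hp : Fact p.Prime]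

/-- **The V-gain at any even depth `N ≥ 1`, any `d`, any direction `j`**: if every class of exponent `< −N` is a tame single and every class at
`−N` is a tame single or a centre-free palindromic class, and `R ≤ 1`, `R ≤ 3 + E_x` on every multipole class, then
`v_p(Cas_j(b)) ≥ (1 − N) + R` for `p ≤ d(b)` and `≥ (1 − N) + min R 0` always. -/
theorem vgain_anyDepth (b : ℕ → ℤ) (j : ℕ) (hb : InPolytope b) (hb' : InPolytope (shift b j)) (hj1 : 1 ≤ j) (hj7 : j ≤ 7)
    (hp5 : 5 ≤ p) (hpb : (p : ℤ) ≤ b 0) (hwin : (b 0 + 2 : ℤ) < (p : ℤ) ^ 2) {N : ℕ} (hN : 1 ≤ N) (hNe : Even N)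
    (hT : ∀ x, x < p → classExp b p x < -(N : ℤ) → classPoleCount b p x = 1 ∧ tameSingle b p x = true)
    (hD : ∀ x ∈ deepClasses b p N, (classPoleCount b p x = 1 ∧ tameSingle b p x = true) ∨
      (¬ CentreIn b p x ∧ (∀ s ∈ classSet b p x, netExp b s = netExp b ((b 0).toNat - ((b 0).toNat - x) % p - (s - x)))))
    (R : ℤ) (hR1 : R ≤ 1) (hRm : ∀ x, x < p → 2 ≤ classPoleCount b p x → R ≤ 3 + classExp b p x)
    (hcas : casoratian b j ≠ 0) :
    (1 - (N : ℤ)) + (if (p : ℤ) ≤ dOf b then R else min R 0) ≤ padicValRat p (casoratian b j) := by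
  have hp0 : 0 < p := hp.out.pos
  have h0 : 0 ≤ b 0 := hb.1.1
  have hpn : p ≤ (b 0).toNat := by
    have : (((b 0).toNat : ℕ) : ℤ) = b 0 := Int.toNat_of_nonneg h0
    omega
  have hwin' : (shift b j 0 + 2 : ℤ) < (p : ℤ) ^ 2 := by rwa [shift_zero b hj1]
  have hpn' : p ≤ (shift b j 0).toNat := by rwa [shift_zero b hj1]
  have hHb := ddHyp_self b hT hD
  have hHb' := ddHyp_shift b hb hj1 hp0 hT hD
  have hV := padicNorm_coeffV_le_ddTwo b hb hp5 hpn hwin hN hNe hHb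
  have hV' := padicNorm_coeffV_le_ddTwo (shift b j) hb' hp5 hpn' hwin' hN hNe hHb'
  refine VCarrier.cas_val_ge_of_coeffV b hb hj1 hj7 hb' hp5 hwin (1 - (N : ℤ)) _ hV hV' ?_ ?_ ?_ hcas
  · split_ifs
    · exact hR1
    · exact (min_le_left _ _).trans hR1
  · intro x hx h2
    have h := hRm x hx h2
    split_ifs
    · exact h
    · exact (min_le_left _ _).trans h
  · intro hd
    rw [if_neg (by push Not; exact hd)]
    exact min_le_right _ _

/-- **The V-gain from a cover**: the class hypotheses read off gen 10's `checkB` at `N` on the cover's type list, the multipole-row bound off the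
list of types with at least two poles. -/
theorem vgain_of_cover {b : ℕ → ℤ} {j : ℕ} (hb : InPolytope b) (hj1 : 1 ≤ j) (hj7 : j ≤ 7)
    (hb' : InPolytope (shift b j)) (hp5 : 5 ≤ p) (hpb : (p : ℤ) ≤ b 0)
    (hwin : (b 0 + 2 : ℤ) < (p : ℤ) ^ 2) {TY : List (List ℤ × Bool)} (hcov : Cover b p TY) {N : ℕ} (hN : 1 ≤ N) (hNe : Even N)
    (hchk : checkB (decide (¬ (2 : ℤ) ∣ b 0)) TY N = true) (R : ℤ) (hR1 : R ≤ 1)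
    (hrows : ∀ tc ∈ TY, 2 ≤ polesL tc.1 → R ≤ 3 + expL (decide (¬ (2 : ℤ) ∣ b 0)) tc.1 tc.2)
    (hcas : casoratian b j ≠ 0) :
    (1 - (N : ℤ)) + (if (p : ℤ) ≤ dOf b then R else min R 0) ≤ padicValRat p (casoratian b j) := by
  rw [checkB, List.all_eq_true] at hchk
  refine vgain_anyDepth b j hb hb' hj1 hj7 hp5 hpb hwin hN hNe ?_ ?_ R hR1 ?_ hcas
  · intro x hx hE
    obtain ⟨tc, htc, ht⟩ := hcov x hx
    have hc0 := hchk tc htc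
    simp only [Bool.or_eq_true, Bool.not_eq_true', decide_eq_false_iff_not, Bool.and_eq_true,
      decide_eq_true_eq] at hc0
    have hc := hc0.1
    rw [ht.classExp_eq] at hE
    rw [ht.classPoleCount_eq, ht.tameSingle_eq]
    rcases hc with h | h
    · exact absurd hE h
    · exact h
  · intro x hxd
    obtain ⟨hx, hE⟩ := (mem_deepClasses_iff b p N x).1 hxd
    obtain ⟨tc, htc, ht⟩ := hcov x hx
    have hc0 := hchk tc htc
    simp only [Bool.or_eq_true, Bool.not_eq_true', decide_eq_false_iff_not, Bool.and_eq_true,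
      decide_eq_true_eq] at hc0
    have hc := hc0.2
    rw [ht.classExp_eq] at hE
    rcases hc with h | h | ⟨hc1, hc2⟩
    · exact absurd hE h
    · left; rw [ht.classPoleCount_eq, ht.tameSingle_eq]; exact h
    · right
      refine ⟨fun hcen => ?_, ht.pal_classSet hc2⟩
      have := ht.cen_iff.1 hcen
      rw [this] at hc1
      exact Bool.noConfusion hc1
  · intro x hx h2
    obtain ⟨tc, htc, ht⟩ := hcov x hx
    rw [ht.classPoleCount_eq] at h2
    rw [ht.classExp_eq]
    exact hrows tc htc h2

/-- **Cover form with an explicit target value**: `c ≤ v_p(Cas_j(b))` for any `c ≤ (1 − N) + R` with also `c ≤ (1 − N) + min R 0` unless `p ≤ d`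
is known — here in the two usual shapes: `c₁` at `p ≤ d` and `c₀` at any depth. -/
theorem cover_VG_j {b : ℕ → ℤ} {j : ℕ} (hb : InPolytope b) (hj1 : 1 ≤ j) (hj7 : j ≤ 7) (hb' : InPolytope (shift b j))
    (hp5 : 5 ≤ p) (hpb : (p : ℤ) ≤ b 0) (hwin : (b 0 + 2 : ℤ) < (p : ℤ) ^ 2)
    {TY : List (List ℤ × Bool)} (hcov : Cover b p TY) {N : ℕ} (hN : 1 ≤ N) (hNe : Even N)
    (hchk : checkB (decide (¬ (2 : ℤ) ∣ b 0)) TY N = true) (R : ℤ) (hR1 : R ≤ 1)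
    (hrows : ∀ tc ∈ TY, 2 ≤ polesL tc.1 → R ≤ 3 + expL (decide (¬ (2 : ℤ) ∣ b 0)) tc.1 tc.2)
    {c : ℤ} (hc : c ≤ 1 - (N : ℤ) + min R 0 ∨ ((p : ℤ) ≤ dOf b ∧ c ≤ 1 - (N : ℤ) + R)) (hcas : casoratian b j ≠ 0) :
    c ≤ padicValRat p (casoratian b j) := by
  have h := vgain_of_cover hb hj1 hj7 hb' hp5 hpb hwin hcov hN hNe hchk R hR1 hrows hcas
  refine le_trans ?_ h
  rcases hc with hc | ⟨hpd, hc⟩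
  · split_ifs
    · exact hc.trans (by linarith [min_le_left R 0])
    · exact hc
  · rw [if_pos hpd]; exact hc

end Summit.KontsevichZagierPeriods.Zeta5Search.DenomLaw

end
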